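import Literature.MathematicalPhysics.QuantumFieldTheory.Balaban1983to89.Node00.Sect2RegionGeometry
import Literature.MathematicalPhysics.QuantumFieldTheory.Balaban1983to89.Node00.RateRecordW1Reading
import Literature.MathematicalPhysics.QuantumFieldTheory.Balaban1983to89.Node00.Record12Residuals
import Literature.MathematicalPhysics.QuantumFieldTheory.Balaban1983to89.Node00.Record13
import Literature.MathematicalPhysics.QuantumFieldTheory.Balaban1983to89.B12RegularSpaces111Mono
import Summits.QuantumFields.YangMills.Theorems.BalabanUVNodesN18HLayerW1ConfigRecord

/-!
# BalabanUVNodes ∕ N18 — THE RESTRICTION PROPERTY OF [II] p. 15 AT THE TABLE OF RECORD: `U^c_j(X, α₀, α₁)` IS ANTITONE IN THE DOMAIN modulo condition (iv),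
# and `W1.SpRestr (W1.spaceOfRecord …)` HOLDS at the residual recipe OF RECORD (Track A, DAG node N18 = NE5 `T4OutputRate.NE5 EA EB W κ θ C₅` :211; cluster K4
# «SpineRates»; file 20 of seat pub-ymgap-dag-n18-c, row s1, generation 5)

Cell `pub-ymgap`, HUMAN RULING D-0062 (Track A), R134 ACCELERATION seat `pub-ymgap-dag-n18-c` (strategy s1), generation 5.  THEOREMS ONLY (no `def`, no `instance`,
no `sorry`); imports dag-n09-c's `Node00/Sect2RegionGeometry` (monotonicity of `regionOfSet` ∕ `innerT`, the faces of 11b's `frameI`), node00-def-W1's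
`Node00/RateRecordW1Reading` (`W1.spaceOfRecord`, `W1.SpRestr`, `W1.ClusterStep.domSites_mono`, def-T's `settingOfRecord₁₂`), def-T's `Node00/Record13` v1.1
(`settingOfRecord₁₃`), K0c's `Node00/Record12Residuals` (`Sect2.Residual.unit`,
`RzOfRecord`, `Stage12Params.HasResidualsOfRecord`), pub-balaban's `B12RegularSpaces111Mono` (monotonicity in the radii) and this seat's file 10
`…N18HLayerW1ConfigRecord` (the any-table consumers, for §5) BY NAME; restates nothing of them.  `--supports` K3′ (helper).

WHY.  Every configuration-direction file of this seat at W1's objects (files 9–18: `…N18HLayerW1Config(Record)`, `…Thickened`, `…Lemma3Config`, `…Induction(Terms)`,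
`…Recursion(Terms)`), dag-n18-d's m11–m15 (`hrestrA ∕ hrestrB`; trivial at m13's constant plaquette-small tables) and dag-n27-c's XXXI DISPLAY the restriction property
of the space table — `W1.SpRestr (sp (k+1))`: «Z ⊂ X ⟹ sp X ⊆ sp Z» ([II] p. 15: the activities of the polymers `Z ⊂ X` are evaluated at the configurations of the space
on `X`).
Nobody discharged it at THE table of record `W1.spaceOfRecord Sg Rz α₀ α₁` = 11b's `Sect2.spaceI` on the site set of `X` = [I] (1.11)–(1.16)'s union of orbits
`B12RegularSpaces111.space` on the frame of record `frameI Rz M j Y = ⟨X(Y), cubes(Y), X̃⁻²(Y), Rz.bgI j Y⟩`.  THIS FILE: conditions (i)–(iii) and the orbit structure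
are ANTITONE in the frame (a configuration regular on `X` is regular on `Z ⊂ X`: fewer plaquettes, bonds, stencils and cubes to check; the (1.12) cubes of `Z` are
sub-regions of those of `X`) — PROVED (§1–§2); condition (iv) (1.15)–(1.16) reads the background functions `U_n(M˙(·)), J_n(M˙(·))` which the typed frame builds FROM
THE DOMAIN (`Rz.bgI j Y`, «X as Ω₀»), so (iv) on `X` implies (iv) on `Z` only under a law of the residual recipe — DISPLAYED as the hypothesis `hIV` (§1's
`satisfies_anti_frame`, §3's `spRestr_spaceOfRecord_of_condIV`).  AT THE RECORD the residual recipe is K0c's UNIT placeholder (`RzOfRecord F N K = Sect2.Residual.unit`,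
`U_n ≡ 1`, `J_n ≡ 0`, (C3) of `Record12Residuals` — DOMAIN-INDEPENDENT), so the law holds by `rfl` and **`W1.SpRestr (W1.spaceOfRecord …)` IS A THEOREM at the table
of record AS TYPED** (§3 ★★★ `spRestr_spaceOfRecord₁₂_of_hasResidualsOfRecord`).  LOCATED, honestly: print does NOT claim the same-table inclusion for its own
(domain-dependent, [15]-built) backgrounds — [II] p. 15 restricts THROUGH A LARGER SPACE («analytic functions on the space of configurations (U, J) satisfying the
conditions I.(i)–(iii) on the domain Z, with constants α₀′, α₁′ much bigger than α₀, α₁, therefore we can restrict them … to the above subspace» `U^c_{k+1}(X, α₀, α₁)`;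
and «extended to functions … analytic on the space U^c_{k+1}(Y, (1+β)α₀, (1+β)α₁, α₀)») — §4 types that print-shaped inclusion (radii growing, (iv) transferred or
absent); when (C3)'s body is swapped for [14]∕[15]'s analytic backgrounds, `hIV` becomes CONTENT ([15]'s locality of the minimizers) and the same-table `SpRestr` must be
revisited (cc node00-def-R ∕ K0c ∕ node00-def-W1).

WHAT (theorems only).
* §1 [I] (1.11)–(1.16) ANTITONE IN THE FRAME (any torus, any model): `condI_anti_frame`, `condII_anti_region`, `condIII_anti_region`, `condIV_anti_region` (same
  background functions), `satisfies_anti_frame` ((iv) transferred by the displayed `hIV`), ★ `space_anti_frame` (`U^c(F) ⊆ U^c(F′)` for a refined frame `F′ ≼ F`),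
  `space_anti_frame_mono` (+ radii growing, `B12RegularSpaces111Mono.space_mono`).
* §2 THE FRAME OF RECORD IS MONOTONE IN THE SITE SET: `cubesI_refine` (every (1.12) cube-region of `Y′ ⊆ Y` is a sub-region of one of `Y`), `frameI_X₂_plaqs_mono` ∕
  `frameI_X₂_bonds_mono` (`X̃⁻²` monotone, dag-n09-c's `innerT_mono`), ★ `spaceI_anti_of_condIV` (`Y′ ⊆ Y` + (iv)-transfer ⟹ `spaceI … Y ⊆ spaceI … Y′`),
  `spaceI_anti_of_bgI_eq` (domain-independent recipes: unconditional), `spaceI_anti_mono_of_condIV` (print's shape: radii growing).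
* §3 AT W1's TABLE: ★ `spRestr_spaceOfRecord_of_condIV` (general `Rz`, law displayed), ★★ `spRestr_spaceOfRecord_of_bgI_eq` (domain-independent `Rz`),
  `spRestr_spaceOfRecord_unit` (`Sect2.Residual.unit`), `spRestr_spaceOfRecord_rzOfRecord` (`RzOfRecord F N K`), ★★★ `spRestr_spaceOfRecord₁₂_of_hasResidualsOfRecord`
  (at `settingOfRecord₁₂ F N θ p`, `θ.Rz K` on any torus `F.P K`, any radii tables `α₀ α₁ : ℕ → ℝ`, any cube size: the `hrestrA ∕ hrestrB` of dag-n18-d's m11–m15, of dag-n27-c's XXXI and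
  of files 9–18 at the table of record DISCHARGED for every `θ` carrying the residuals of record); `spRestr_spaceOfRecord₁₃_of_hasResidualsOfRecord` (+ `_succ_`) —
  the same at rev 16's Stage-13 setting `settingOfRecord₁₃ F N θ p`.
* §4 PRINT's SHAPE ([II] p. 15, [I] (3.16)): `spaceOfRecord_subset_spaceI_of_le` — `U^c_j(X, α₀, α₁) ⊆ U^c_j(Z, α₀′, α₁′)` for `Z ⊂ X`, `α ≤ α′`, `0 ≤ O(1)LMB`, under the
  (iv)-transfer law; unconditional at domain-independent recipes (`…_of_bgI_eq`).
* §5 CONSUMERS AT THE TABLE OF RECORD, `hrestr` DISCHARGED: file 10's any-table (1.18) ∕ [I] p. 263 analyticity producers `termBound118_of_bound238_table` ∕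
  `termAnalytic_of_bound238_table` at `sp := W1.spaceOfRecord (settingOfRecord₁₂ F N θ p) (θ.Rz K) α₀ α₁` for `θ.HasResidualsOfRecord`:
  `termBound118_of_bound238_spaceOfRecord₁₂`, `termAnalytic_of_bound238_spaceOfRecord₁₂` (what remains displayed: W1's `AnalyticH` ∕ `Bound238` per step ON THE
  TABLE OF RECORD — NODE A's content — and the numerals).

HONEST FRAMING.  Count-neutral kernel bookkeeping (set inclusions over [I] (1.11)–(1.16) as typed by pub-balaban r2 and 11b); NOT a discharge of N18 (typed 28∕28 ·
discharged 5∕27 UNCHANGED); the discharge of `SpRestr` at the record rides on the UNIT residual placeholder (C3) — print's backgrounds are domain-dependent and print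
restricts through larger radii; nothing of Bałaban's analysis is asserted; NE5 NOT IN PRINT ∕ NOT PROVED; one finite four-torus programme at fixed ε — NOT infinite
volume, NOT OS on ℝ⁴, NOT a mass gap, NOT Clay.  0 `sorry`, 0 `def`, standard axioms.

References (TYPES only): [I] = [Balaban1987RG1] (1.11)–(1.16) p. 262, (1.19) p. 263, (3.16) p. 273; [II] = [Balaban1988RG2Cluster] p. 15 (the restriction to the
subspace, quoted above), (2.13) p. 14; [III] = [Balaban1988Convergent] (2.27)–(2.28) p. 259 (the spaces of record along the flow).
-/

noncomputable section

namespace Summit.QuantumFields.YangMills.BalabanUVNodes.N18HLayerW1SpaceRestr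

open Set
open scoped Matrix.Norms.L2Operator
open Literature.MathematicalPhysics.QuantumFieldTheory.Balaban1983to89
open Step B14DomainGeom B14.Eq213MaximalDomains B15Eq112TorusCover TreeLengthTorus
open Literature.MathematicalPhysics.QuantumFieldTheory.Balaban1983to89.B12RegularSpaces111
open Literature.MathematicalPhysics.QuantumFieldTheory.Balaban1983to89.B12RegularSpaces111Mono (space_mono)
open Literature.MathematicalPhysics.QuantumFieldTheory.Balaban1983to89.T4Continuum (T4Family)
open Literature.MathematicalPhysics.QuantumFieldTheory.Balaban1983to89.Node00
open Literature.MathematicalPhysics.QuantumFieldTheory.Balaban1983to89.Node00.Sect2 (regionOfSet innerT cubesI frameI spaceI domSys domSites Residual Setting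
  regionOfSet_plaqs_mono regionOfSet_bonds_mono regionOfSet_dpairs_mono innerT_mono frameI_X frameI_X₂)
open Literature.MathematicalPhysics.QuantumFieldTheory.Balaban1983to89.B12TreeDecay (K₀)
open Literature.MathematicalPhysics.QuantumFieldTheory.Balaban1983to89.Node00.W1 (spaceOfRecord SpRestr ClusterTower TermBound118 TermAnalytic restrictPrefix)
open Literature.MathematicalPhysics.QuantumFieldTheory.Balaban1983to89.Node00.W1.ClusterStep (domSites_mono)

/-! ## §1 [I] (1.11)–(1.16) are antitone in the frame -/

section Frame

variable {P : Params} {i : ℕ} {𝔸 : Type*} [NormedRing 𝔸] [NormedAlgebra ℂ 𝔸] [CompleteSpace 𝔸] {𝓜 : Model 𝔸}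

/-- **(i) is antitone in the frame**: if `F′.X` has fewer bonds and plaquettes than `F.X` and every (1.12) cube-region of `F′` is a sub-region (bonds, stencils) of a
cube-region of `F`, then condition (i) on `F` implies condition (i) on `F′` (same constants; the local gauge `u` and the field `A` of the bigger cube serve the smaller).
[cite: Balaban1987RG1, (1.11)-(1.12) p.262] -/
theorem condI_anti_frame {F F' : Frame P i 𝔸} {c : StepConsts} {α₀ : ℝ} (hXb : F'.X.bonds ⊆ F.X.bonds) (hXp : F'.X.plaqs ⊆ F.X.plaqs)
    (hcubes : ∀ C' ∈ F'.cubes, ∃ C ∈ F.cubes, C'.bonds ⊆ C.bonds ∧ C'.dpairs ⊆ C.dpairs) {U : PBond P i → 𝔸ˣ} (h : CondI 𝓜 F c α₀ U) :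
    CondI 𝓜 F' c α₀ U := by
  refine ⟨fun b hb => h.gValued b (hXb hb), fun p hp => h.plaq_lt p (hXp hp), fun C' hC' => ?_⟩
  obtain ⟨C, hC, hbC, hdC⟩ := hcubes C' hC'
  obtain ⟨u, hu, A, hgauge, hA, hdA⟩ := h.localGauge C hC
  exact ⟨u, hu, A, fun b hb => hgauge b (hbC hb), fun b hb => hA b (hbC hb), fun q hq => hdA q (hdC hq)⟩

omit [CompleteSpace 𝔸] in
/-- **(ii) is antitone in the region** (fewer bonds and stencils to check). [cite: Balaban1987RG1, (1.13) p.262] -/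
theorem condII_anti_region {X X' : Region P i} {c : StepConsts} {α₁ : ℝ} (hb : X'.bonds ⊆ X.bonds) (hd : X'.dpairs ⊆ X.dpairs) {U : PBond P i → 𝔸ˣ}
    {A' : PBond P i → 𝔸} (h : CondII 𝓜 X c α₁ U A') : CondII 𝓜 X' c α₁ U A' :=
  ⟨fun b hb' => h.gcValued b (hb hb'), fun b hb' => h.norm_lt b (hb hb'), fun q hq => h.nabla_lt q (hd hq)⟩

omit [NormedAlgebra ℂ 𝔸] [CompleteSpace 𝔸] in
/-- **(iii) is antitone in the region** (fewer plaquettes and bonds to check). [cite: Balaban1987RG1, (1.14) p.262] -/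
theorem condIII_anti_region {X X' : Region P i} {c : StepConsts} {α₀ γ₀ : ℝ} (hp : X'.plaqs ⊆ X.plaqs) (hb : X'.bonds ⊆ X.bonds)
    {Uc : PBond P i → 𝔸ˣ} {Jc : PBond P i → 𝔸} (h : CondIII X c α₀ γ₀ Uc Jc) : CondIII X' c α₀ γ₀ Uc Jc :=
  ⟨fun p hp' => h.plaq_lt p (hp hp'), fun b hb' => h.J_lt b (hb hb')⟩

omit [NormedAlgebra ℂ 𝔸] [CompleteSpace 𝔸] in
/-- **(iv) is antitone in the region `X̃⁻²` FOR THE SAME BACKGROUND FUNCTIONS** (fewer plaquettes and bonds of `X̃⁻²` to check; the functions `U_n(M˙(·)), J_n(M˙(·))`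
unchanged — the typed frame builds them from the domain, which is where the domain-dependence of (iv) lives). [cite: Balaban1987RG1, (1.15)-(1.16) p.262] -/
theorem condIV_anti_region {bg : BackgroundFns P i 𝔸} {X₂ X₂' : Region P i} {c : StepConsts} {α₀ : ℝ} (hp : X₂'.plaqs ⊆ X₂.plaqs)
    (hb : X₂'.bonds ⊆ X₂.bonds) {V : PBond P i → 𝔸ˣ} (h : CondIV bg X₂ c α₀ V) : CondIV bg X₂' c α₀ V :=
  ⟨fun n hn hnj p hp' => h.plaq_lt n hn hnj p (hp hp'), fun n hn hnj b hb' => h.J_lt n hn hnj b (hb hb')⟩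

/-- **(i)–(iv) are antitone in the frame, (iv) transferred by a displayed law**: frame refinement on `X` and on the cubes + the (iv)-transfer
`∀ V, CondIV F.bg F.X₂ … V → CondIV F′.bg F′.X₂ … V` ⟹ `Satisfies F Φ → Satisfies F′ Φ` (same factorisation `𝐔 = (exp iξA′)U`). [cite: Balaban1987RG1, (1.11)-(1.16) p.262] -/
theorem satisfies_anti_frame {F F' : Frame P i 𝔸} {c : StepConsts} {α₀ α₁ γ₀ : ℝ} (hXp : F'.X.plaqs ⊆ F.X.plaqs) (hXb : F'.X.bonds ⊆ F.X.bonds)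
    (hXd : F'.X.dpairs ⊆ F.X.dpairs) (hcubes : ∀ C' ∈ F'.cubes, ∃ C ∈ F.cubes, C'.bonds ⊆ C.bonds ∧ C'.dpairs ⊆ C.dpairs)
    (hIV : ∀ V : PBond P i → 𝔸ˣ, CondIV F.bg F.X₂ c α₀ V → CondIV F'.bg F'.X₂ c α₀ V) {Φ : FieldPair P i 𝔸ˣ 𝔸}
    (h : Satisfies 𝓜 F c α₀ α₁ γ₀ Φ) : Satisfies 𝓜 F' c α₀ α₁ γ₀ Φ := by
  obtain ⟨hG, hg, U, A', hf, h1, h2, h3, h4, h5⟩ := h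
  exact ⟨fun b hb => hG b (hXb hb), fun b hb => hg b (hXb hb), U, A', hf, condI_anti_frame hXb hXp hcubes h1, condII_anti_region hXb hXd h2,
    condIII_anti_region hXp hXb h3, hIV _ h4, hIV _ h5⟩

/-- **★ THE SPACES ARE ANTITONE IN THE FRAME**: `U^c(F, α₀, α₁, γ₀) ⊆ U^c(F′, α₀, α₁, γ₀)` for a refined frame `F′ ≼ F` (regions and cubes refined, (iv) transferred) —
the union of orbits of the pairs regular on `F` lies in that of the pairs regular on `F′` (same gauge transformation `u`). [cite: Balaban1987RG1, (1.11)-(1.16) p.262 and (1.19) p.263; Balaban1988RG2Cluster, p.15] -/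
theorem space_anti_frame {F F' : Frame P i 𝔸} {c : StepConsts} {α₀ α₁ γ₀ : ℝ} (hXp : F'.X.plaqs ⊆ F.X.plaqs) (hXb : F'.X.bonds ⊆ F.X.bonds)
    (hXd : F'.X.dpairs ⊆ F.X.dpairs) (hcubes : ∀ C' ∈ F'.cubes, ∃ C ∈ F.cubes, C'.bonds ⊆ C.bonds ∧ C'.dpairs ⊆ C.dpairs)
    (hIV : ∀ V : PBond P i → 𝔸ˣ, CondIV F.bg F.X₂ c α₀ V → CondIV F'.bg F'.X₂ c α₀ V) :
    space 𝓜 F c α₀ α₁ γ₀ ⊆ space 𝓜 F' c α₀ α₁ γ₀ := by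
  rintro Φ ⟨u, Φ₀, hu, h₀, rfl⟩
  exact ⟨u, Φ₀, hu, satisfies_anti_frame hXp hXb hXd hcubes hIV h₀, rfl⟩

/-- **The spaces are antitone in the frame AND monotone in the radii** (print's combination, [II] p. 15 ∕ [I] (3.16): the smaller domain with the LARGER constants):
`U^c(F, α₀, α₁, γ₀) ⊆ U^c(F′, α₀′, α₁′, γ₀′)` for `F′ ≼ F`, `α ≤ α′`, `0 ≤ O(1)LMB`. [cite: Balaban1987RG1, (1.17) p.263 and (3.16) p.273; Balaban1988RG2Cluster, p.15] -/
theorem space_anti_frame_mono {F F' : Frame P i 𝔸} {c : StepConsts} (hc : 0 ≤ c.cB) {α₀ α₀' α₁ α₁' γ₀ γ₀' : ℝ} (hα₀ : α₀ ≤ α₀') (hα₁ : α₁ ≤ α₁')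
    (hγ : γ₀ ≤ γ₀') (hXp : F'.X.plaqs ⊆ F.X.plaqs) (hXb : F'.X.bonds ⊆ F.X.bonds) (hXd : F'.X.dpairs ⊆ F.X.dpairs)
    (hcubes : ∀ C' ∈ F'.cubes, ∃ C ∈ F.cubes, C'.bonds ⊆ C.bonds ∧ C'.dpairs ⊆ C.dpairs)
    (hIV : ∀ V : PBond P i → 𝔸ˣ, CondIV F.bg F.X₂ c α₀ V → CondIV F'.bg F'.X₂ c α₀ V) :
    space 𝓜 F c α₀ α₁ γ₀ ⊆ space 𝓜 F' c α₀' α₁' γ₀' :=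
  (space_anti_frame hXp hXb hXd hcubes hIV).trans (space_mono hc hα₀ hα₁ hγ)

end Frame

/-! ## §2 The frame of record is monotone in the site set; `Sect2.spaceI` is antitone in it -/

section Record

variable {P : Params} {𝔸 : Type*} [NormedRing 𝔸] [NormedAlgebra ℂ 𝔸] [CompleteSpace 𝔸]

omit [NormedAlgebra ℂ 𝔸] [CompleteSpace 𝔸] in
/-- **Every (1.12) cube-region of `Y′ ⊆ Y` is a sub-region of a cube-region of `Y`** (same `LM`-cube `□`: `□ ∩ Y′ ⊆ □ ∩ Y`, non-empty if `□ ∩ Y′` is).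
[cite: Balaban1987RG1, (1.12) p.262] -/
theorem cubesI_refine (M j : ℕ) {Y Y' : Set (Site P 0)} (h : Y' ⊆ Y) :
    ∀ C' ∈ cubesI (P := P) M j Y', ∃ C ∈ cubesI (P := P) M j Y, C'.bonds ⊆ C.bonds ∧ C'.dpairs ⊆ C.dpairs := by
  rintro C' ⟨a, ha, hne, rfl⟩
  have hsub : cubeEnl P (side P.L M (j + 1)) a 0 ∩ Y' ⊆ cubeEnl P (side P.L M (j + 1)) a 0 ∩ Y := Set.inter_subset_inter_right _ h
  exact ⟨regionOfSet P (cubeEnl P (side P.L M (j + 1)) a 0 ∩ Y), ⟨a, ha, hne.mono hsub, rfl⟩, regionOfSet_bonds_mono hsub, regionOfSet_dpairs_mono hsub⟩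

omit [NormedAlgebra ℂ 𝔸] [CompleteSpace 𝔸] in
/-- `X̃⁻²` of the frame of record is monotone in the site set, on plaquettes (`innerT_mono`). [cite: Balaban1987RG1, (1.16) p.262] -/
theorem frameI_X₂_plaqs_mono (Rz Rz' : Residual P 𝔸) (M j : ℕ) {Y Y' : Set (Site P 0)} (h : Y' ⊆ Y) :
    (frameI Rz' M j Y').X₂.plaqs ⊆ (frameI Rz M j Y).X₂.plaqs := by
  rw [frameI_X₂, frameI_X₂]
  exact regionOfSet_plaqs_mono (innerT_mono _ _ h)

omit [NormedAlgebra ℂ 𝔸] [CompleteSpace 𝔸] in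
/-- `X̃⁻²` of the frame of record is monotone in the site set, on bonds. [cite: Balaban1987RG1, (1.16) p.262] -/
theorem frameI_X₂_bonds_mono (Rz Rz' : Residual P 𝔸) (M j : ℕ) {Y Y' : Set (Site P 0)} (h : Y' ⊆ Y) :
    (frameI Rz' M j Y').X₂.bonds ⊆ (frameI Rz M j Y).X₂.bonds := by
  rw [frameI_X₂, frameI_X₂]
  exact regionOfSet_bonds_mono (innerT_mono _ _ h)

/-- **★ `Sect2.spaceI` IS ANTITONE IN THE SITE SET modulo (iv)**: for `Y′ ⊆ Y` and a residual recipe whose condition (iv) on `Y` (functions `Rz.bgI j Y`, region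
`X̃⁻²(Y)`) implies condition (iv) on `Y′` — DISPLAYED — the space of record on `Y` lies in the space of record on `Y′` (same setting, cube size, level, radii).
[cite: Balaban1987RG1, (1.11)-(1.16) p.262; Balaban1988Convergent, (2.27)(ii) p.259; Balaban1988RG2Cluster, p.15] -/
theorem spaceI_anti_of_condIV {G : Type*} [Group G] (S : Setting 𝔸 G) (Rz : Residual P 𝔸) (M j : ℕ) {Y Y' : Set (Site P 0)} (h : Y' ⊆ Y) {α₀ α₁ : ℝ}
    (hIV : ∀ V : PBond P 0 → 𝔸ˣ, CondIV (Rz.bgI j Y) (regionOfSet P (innerT P (side P.L M j) 2 Y)) (StepConsts.ofParams P S.cB j) α₀ V →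
      CondIV (Rz.bgI j Y') (regionOfSet P (innerT P (side P.L M j) 2 Y')) (StepConsts.ofParams P S.cB j) α₀ V) :
    spaceI S Rz M j Y α₀ α₁ ⊆ spaceI S Rz M j Y' α₀ α₁ :=
  Set.image_mono (space_anti_frame (F := frameI Rz M j Y) (F' := frameI Rz M j Y') (regionOfSet_plaqs_mono h) (regionOfSet_bonds_mono h)
    (regionOfSet_dpairs_mono h) (cubesI_refine M j h) hIV)

/-- **`Sect2.spaceI` is antitone in the site set at a DOMAIN-INDEPENDENT residual recipe** (`Rz.bgI j Y′ = Rz.bgI j Y`): unconditional, since `X̃⁻²` is monotone.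
[cite: Balaban1987RG1, (1.11)-(1.16) p.262; Balaban1988RG2Cluster, p.15] -/
theorem spaceI_anti_of_bgI_eq {G : Type*} [Group G] (S : Setting 𝔸 G) (Rz : Residual P 𝔸) (M j : ℕ) {Y Y' : Set (Site P 0)} (h : Y' ⊆ Y)
    (hbg : Rz.bgI j Y' = Rz.bgI j Y) (α₀ α₁ : ℝ) : spaceI S Rz M j Y α₀ α₁ ⊆ spaceI S Rz M j Y' α₀ α₁ :=
  spaceI_anti_of_condIV S Rz M j h fun V hV => by
    rw [hbg]
    exact condIV_anti_region (regionOfSet_plaqs_mono (innerT_mono _ _ h)) (regionOfSet_bonds_mono (innerT_mono _ _ h)) hV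

/-- **PRINT's SHAPE at `Sect2.spaceI`** ([II] p. 15, [I] (3.16)): `Y′ ⊆ Y`, (iv) transferred, radii growing `α ≤ α′`, `0 ≤ O(1)LMB` ⟹
`spaceI … Y α₀ α₁ ⊆ spaceI … Y′ α₀′ α₁′`. [cite: Balaban1988RG2Cluster, p.15; Balaban1987RG1, (3.16) p.273] -/
theorem spaceI_anti_mono_of_condIV {G : Type*} [Group G] (S : Setting 𝔸 G) (hS : 0 ≤ S.cB) (Rz : Residual P 𝔸) (M j : ℕ) {Y Y' : Set (Site P 0)}
    (h : Y' ⊆ Y) {α₀ α₀' α₁ α₁' : ℝ} (hα₀ : α₀ ≤ α₀') (hα₁ : α₁ ≤ α₁')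
    (hIV : ∀ V : PBond P 0 → 𝔸ˣ, CondIV (Rz.bgI j Y) (regionOfSet P (innerT P (side P.L M j) 2 Y)) (StepConsts.ofParams P S.cB j) α₀ V →
      CondIV (Rz.bgI j Y') (regionOfSet P (innerT P (side P.L M j) 2 Y')) (StepConsts.ofParams P S.cB j) α₀ V) :
    spaceI S Rz M j Y α₀ α₁ ⊆ spaceI S Rz M j Y' α₀' α₁' :=
  Set.image_mono (space_anti_frame_mono (F := frameI Rz M j Y) (F' := frameI Rz M j Y') (c := StepConsts.ofParams P S.cB j) hS hα₀ hα₁ hα₀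
    (regionOfSet_plaqs_mono h) (regionOfSet_bonds_mono h) (regionOfSet_dpairs_mono h) (cubesI_refine M j h) hIV)

end Record

/-! ## §3 At W1's table: `W1.SpRestr (W1.spaceOfRecord …)` -/

section Table

variable {P : Params} {𝔸 : Type*} [NormedRing 𝔸] [NormedAlgebra ℂ 𝔸] [CompleteSpace 𝔸] {M : ℕ}

/-- **★ THE RESTRICTION PROPERTY AT W1's TABLE OF RECORD, general residual recipe**: if condition (iv) of the recipe transfers from the site set of `X` to that of
every `Z ⊂ X` at level `j` (DISPLAYED law `hIV` — at print's [15]-built backgrounds this is content), then `W1.SpRestr (W1.spaceOfRecord Sg Rz α₀ α₁ j)`: «Z ⊂ X ⟹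
U^c_j(X) ⊆ U^c_j(Z)». [cite: Balaban1988RG2Cluster, p.15; Balaban1987RG1, (1.11)-(1.16) p.262] -/
theorem spRestr_spaceOfRecord_of_condIV {G : Type*} [Group G] (Sg : Setting 𝔸 G) (Rz : Residual P 𝔸) (α₀ α₁ : ℕ → ℝ) (j : ℕ)
    (hIV : ∀ X Z : (domSys P M j).Dom, (Subtype.val Z : Finset (TPt P.d (Sect2.domCount P M j))) ⊆ Subtype.val X →
      ∀ V : PBond P 0 → 𝔸ˣ, CondIV (Rz.bgI j (domSites P M j X)) (regionOfSet P (innerT P (side P.L M j) 2 (domSites P M j X))) (StepConsts.ofParams P Sg.cB j) (α₀ j) V →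
        CondIV (Rz.bgI j (domSites P M j Z)) (regionOfSet P (innerT P (side P.L M j) 2 (domSites P M j Z))) (StepConsts.ofParams P Sg.cB j) (α₀ j) V) :
    SpRestr (spaceOfRecord (M := M) Sg Rz α₀ α₁ j) :=
  fun X Z hZX => spaceI_anti_of_condIV Sg Rz M j (domSites_mono hZX) (hIV X Z hZX)

/-- **★★ THE RESTRICTION PROPERTY AT W1's TABLE for a DOMAIN-INDEPENDENT residual recipe** (`Rz.bgI j Y = Rz.bgI j Y′` for all site sets): unconditional.
[cite: Balaban1988RG2Cluster, p.15; Balaban1987RG1, (1.11)-(1.16) p.262] -/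
theorem spRestr_spaceOfRecord_of_bgI_eq {G : Type*} [Group G] (Sg : Setting 𝔸 G) (Rz : Residual P 𝔸) (α₀ α₁ : ℕ → ℝ) (j : ℕ)
    (hbg : ∀ Y Y' : Set (Site P 0), Rz.bgI j Y = Rz.bgI j Y') : SpRestr (spaceOfRecord (M := M) Sg Rz α₀ α₁ j) :=
  fun _ _ hZX => spaceI_anti_of_bgI_eq Sg Rz M j (domSites_mono hZX) (hbg _ _) (α₀ j) (α₁ j)

/-- **THE RESTRICTION PROPERTY AT W1's TABLE for the UNIT recipe `Sect2.Residual.unit`** (K0c's placeholder (C3): `U_n(M˙(·)) ≡ 1`, `J_n ≡ 0` — domain-independent by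
`rfl`). [cite: Balaban1988RG2Cluster, p.15; Balaban1987RG1, (1.15)-(1.16) p.262] -/
theorem spRestr_spaceOfRecord_unit {G : Type*} [Group G] (Sg : Setting 𝔸 G) (α₀ α₁ : ℕ → ℝ) (j : ℕ) :
    SpRestr (spaceOfRecord (M := M) Sg (Sect2.Residual.unit P 𝔸) α₀ α₁ j) :=
  spRestr_spaceOfRecord_of_bgI_eq Sg _ α₀ α₁ j fun _ _ => rfl

/-- **THE RESTRICTION PROPERTY AT W1's TABLE for `RzOfRecord F N K`** (K0c's residual §2 data of record, torus by torus — the unit recipe in `M_N(ℂ)`).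
[cite: Balaban1988RG2Cluster, p.15; Balaban1987RG1, (1.15)-(1.16) p.262] -/
theorem spRestr_spaceOfRecord_rzOfRecord (F : T4Family) (N : ℕ) (K : ℕ) (Sg : Setting (MatA N) (SU N)) (α₀ α₁ : ℕ → ℝ) (j : ℕ) :
    SpRestr (spaceOfRecord (M := M) Sg (RzOfRecord F N K) α₀ α₁ j) :=
  spRestr_spaceOfRecord_unit Sg α₀ α₁ j

/-- **★★★ THE RESTRICTION PROPERTY AT THE TABLE OF RECORD of an admissible Stage-12 tuple carrying the residuals of record**: at the setting of record
`settingOfRecord₁₂ F N θ p` (any run `p`), the residual data `θ.Rz K` on ANY torus `F.P K` (`= RzOfRecord F N K` by `HasResidualsOfRecord.Rz_eq`), ANY radii tables `α₀ α₁ : ℕ → ℝ` (e.g. the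
(2.28) radii along `gOfRecord₁₀`) and ANY cube size `M` (e.g. `θ.τ9.M`): `W1.SpRestr (W1.spaceOfRecord (settingOfRecord₁₂ F N θ p) (θ.Rz K) α₀ α₁ j)` — the
hypothesis `hrestrA ∕ hrestrB` of dag-n18-d's m11 ∕ m12 ∕ m14 ∕ m15, of dag-n27-c's XXXI and of this seat's files 9–18, at the table of record, for every level `j`.  Rides on (C3) = the unit
placeholder; revisit when print's [15]-built backgrounds replace it (then §3's `…_of_condIV` with a proved locality law). [cite: Balaban1988RG2Cluster, p.15; Balaban1987RG1, (1.11)-(1.16) p.262; Balaban1988Convergent, (2.27)-(2.28) p.259] -/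
theorem spRestr_spaceOfRecord₁₂_of_hasResidualsOfRecord (F : T4Family) (N : ℕ) [NeZero N] (θ : Stage12Params F N) (hθ : θ.HasResidualsOfRecord)
    (p : B12.RunParams) (K : ℕ) (α₀ α₁ : ℕ → ℝ) (j : ℕ) :
    SpRestr (spaceOfRecord (M := M) (settingOfRecord₁₂ F N θ p) (θ.Rz K) α₀ α₁ j) := by
  rw [hθ.Rz_eq]
  exact spRestr_spaceOfRecord_rzOfRecord F N K _ α₀ α₁ j

/-- The same for all levels at once, in the shape `∀ m, SpRestr (sp (m + 1))` the consumers display (`sp j X := spaceOfRecord … j X`).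
[cite: Balaban1988RG2Cluster, p.15] -/
theorem spRestr_spaceOfRecord₁₂_succ_of_hasResidualsOfRecord (F : T4Family) (N : ℕ) [NeZero N] (θ : Stage12Params F N) (hθ : θ.HasResidualsOfRecord)
    (p : B12.RunParams) (K : ℕ) (α₀ α₁ : ℕ → ℝ) :
    ∀ m : ℕ, SpRestr (spaceOfRecord (M := M) (settingOfRecord₁₂ F N θ p) (θ.Rz K) α₀ α₁ (m + 1)) :=
  fun m => spRestr_spaceOfRecord₁₂_of_hasResidualsOfRecord F N θ hθ p K α₀ α₁ (m + 1)

/-- **THE SAME AT STAGE 13** (rev 16's record: `settingOfRecord₁₃ F N θ p` of def-T's `Node00/Record13`, residual data `θ.Rz K` inherited from the Stage-12 fields):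
`W1.SpRestr (W1.spaceOfRecord (settingOfRecord₁₃ F N θ p) (θ.Rz K) α₀ α₁ j)` (any run `p`, any torus `F.P K`) for every `θ : Stage13Params F N` whose Stage-12 part carries the
residuals of record.
[cite: Balaban1988RG2Cluster, p.15; Balaban1987RG1, (1.11)-(1.16) p.262; Balaban1988Convergent, (2.27)-(2.28) p.259] -/
theorem spRestr_spaceOfRecord₁₃_of_hasResidualsOfRecord (F : T4Family) (N : ℕ) [NeZero N] (θ : Stage13Params F N)
    (hθ : θ.toStage12Params.HasResidualsOfRecord) (p : B12.RunParams) (K : ℕ) (α₀ α₁ : ℕ → ℝ) (j : ℕ) :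
    SpRestr (spaceOfRecord (M := M) (settingOfRecord₁₃ F N θ p) (θ.Rz K) α₀ α₁ j) := by
  have hRz : θ.Rz = RzOfRecord F N := hθ.Rz_eq
  rw [hRz]
  exact spRestr_spaceOfRecord_rzOfRecord F N K _ α₀ α₁ j

/-- Stage 13, all levels, in the consumers' shape `∀ m, SpRestr (sp (m + 1))`. [cite: Balaban1988RG2Cluster, p.15] -/
theorem spRestr_spaceOfRecord₁₃_succ_of_hasResidualsOfRecord (F : T4Family) (N : ℕ) [NeZero N] (θ : Stage13Params F N)
    (hθ : θ.toStage12Params.HasResidualsOfRecord) (p : B12.RunParams) (K : ℕ) (α₀ α₁ : ℕ → ℝ) :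
    ∀ m : ℕ, SpRestr (spaceOfRecord (M := M) (settingOfRecord₁₃ F N θ p) (θ.Rz K) α₀ α₁ (m + 1)) :=
  fun m => spRestr_spaceOfRecord₁₃_of_hasResidualsOfRecord F N θ hθ p K α₀ α₁ (m + 1)

end Table

/-! ## §4 Print's shape: the smaller domain with the larger radii -/

section Print

variable {P : Params} {𝔸 : Type*} [NormedRing 𝔸] [NormedAlgebra ℂ 𝔸] [CompleteSpace 𝔸] {M : ℕ}

/-- **[II] p. 15 ∕ [I] (3.16) AT W1's TABLE**: for `Z ⊂ X` in `𝐃_j`, radii `α₀ j ≤ α₀′`, `α₁ j ≤ α₁′`, `0 ≤ O(1)LMB` and the (iv)-transfer law of the recipe,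
`U^c_j(X, α₀, α₁) ⊆ U^c_j(Z, α₀′, α₁′)` — «analytic on the space of configurations … satisfying the conditions … on the domain Z, with constants α₀′, α₁′ much
bigger than α₀, α₁, therefore we can restrict them … to the above subspace». [cite: Balaban1988RG2Cluster, p.15; Balaban1987RG1, (3.16) p.273] -/
theorem spaceOfRecord_subset_spaceI_of_le {G : Type*} [Group G] (Sg : Setting 𝔸 G) (hS : 0 ≤ Sg.cB) (Rz : Residual P 𝔸) (α₀ α₁ : ℕ → ℝ) (j : ℕ)
    {X Z : (domSys P M j).Dom} (hZX : (Subtype.val Z : Finset (TPt P.d (Sect2.domCount P M j))) ⊆ Subtype.val X) {α₀' α₁' : ℝ}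
    (hα₀ : α₀ j ≤ α₀') (hα₁ : α₁ j ≤ α₁')
    (hIV : ∀ V : PBond P 0 → 𝔸ˣ, CondIV (Rz.bgI j (domSites P M j X)) (regionOfSet P (innerT P (side P.L M j) 2 (domSites P M j X))) (StepConsts.ofParams P Sg.cB j)
        (α₀ j) V →
      CondIV (Rz.bgI j (domSites P M j Z)) (regionOfSet P (innerT P (side P.L M j) 2 (domSites P M j Z))) (StepConsts.ofParams P Sg.cB j) (α₀ j) V) :
    spaceOfRecord (M := M) Sg Rz α₀ α₁ j X ⊆ spaceI Sg Rz M j (domSites P M j Z) α₀' α₁' :=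
  spaceI_anti_mono_of_condIV Sg hS Rz M j (domSites_mono hZX) hα₀ hα₁ hIV

/-- The same at a DOMAIN-INDEPENDENT recipe: unconditional in (iv). [cite: Balaban1988RG2Cluster, p.15; Balaban1987RG1, (3.16) p.273] -/
theorem spaceOfRecord_subset_spaceI_of_le_of_bgI_eq {G : Type*} [Group G] (Sg : Setting 𝔸 G) (hS : 0 ≤ Sg.cB) (Rz : Residual P 𝔸) (α₀ α₁ : ℕ → ℝ) (j : ℕ)
    (hbg : ∀ Y Y' : Set (Site P 0), Rz.bgI j Y = Rz.bgI j Y') {X Z : (domSys P M j).Dom}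
    (hZX : (Subtype.val Z : Finset (TPt P.d (Sect2.domCount P M j))) ⊆ Subtype.val X) {α₀' α₁' : ℝ} (hα₀ : α₀ j ≤ α₀') (hα₁ : α₁ j ≤ α₁') :
    spaceOfRecord (M := M) Sg Rz α₀ α₁ j X ⊆ spaceI Sg Rz M j (domSites P M j Z) α₀' α₁' :=
  spaceOfRecord_subset_spaceI_of_le Sg hS Rz α₀ α₁ j hZX hα₀ hα₁ fun V hV => by
    rw [hbg (domSites P M j Z) (domSites P M j X)]
    exact condIV_anti_region (regionOfSet_plaqs_mono (innerT_mono _ _ (domSites_mono hZX)))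
      (regionOfSet_bonds_mono (innerT_mono _ _ (domSites_mono hZX))) hV

end Print

/-! ## §5 Consumers at the table of record: file 10's any-table producers with `hrestr` discharged -/

section Consumers

variable (F : T4Family) (N : ℕ) [NeZero N] {M : ℕ}

open Classical in
/-- **[I] (1.18) FROM W1's NAMED PAIR ON THE TABLE OF RECORD, NO RESTRICTION CLAUSE**: file 10's `termBound118_of_bound238_table` at
`sp := W1.spaceOfRecord (settingOfRecord₁₂ F N θ p) (θ.Rz K) α₀ α₁` (torus `F.P K`, run `p`, any cube size `M`, any radii tables) for a Stage-12 tuple carrying the residuals of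
record — its hypothesis `hrestr` discharged by §3; displayed remain the per-step `AnalyticH` ∕ `Bound238` on the table of record (NODE A ∕ N10's Lemmas 1–3 for the terms of
record), the window law and the located numerals (rate clause, STRICT [KP86] clause). [cite: Balaban1987RG1, (1.18) p.263; Balaban1988RG2Cluster, p.15, Lemma 3 (2.38) p.20, (2.41) p.21] -/
theorem termBound118_of_bound238_spaceOfRecord₁₂ (θ : Stage12Params F N) (hθ : θ.HasResidualsOfRecord) (p : B12.RunParams) (K : ℕ) (α₀ α₁ : ℕ → ℝ)
    (S : ClusterTower (F.P K) (MatA N) M) (W : Set (ℕ → ℝ)) (Wk : (k : ℕ) → Set (Fin (k + 1) → ℝ)) {A R r₁ : ℝ}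
    (hW : ∀ k, ∀ g ∈ W, restrictPrefix k g ∈ Wk k)
    (han : ∀ k, (S k).AnalyticH (Wk k) (spaceOfRecord (M := M) (settingOfRecord₁₂ F N θ p) (θ.Rz K) α₀ α₁ (k + 1)))
    (h238 : ∀ k, (S k).Bound238 (Wk k) (spaceOfRecord (M := M) (settingOfRecord₁₂ F N θ p) (θ.Rz K) α₀ α₁ (k + 1)) A R) (hA : 0 ≤ A) (hr₁ : 0 ≤ r₁)
    (hrate : r₁ + 2 * (64 * Real.log 162) + 2 ≤ R) (hsmall : A * Real.exp (5 * r₁ + 1) * K₀ 64 8 * 9 * 64 < 1) :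
    TermBound118 S W (spaceOfRecord (M := M) (settingOfRecord₁₂ F N θ p) (θ.Rz K) α₀ α₁) (Real.exp 1 * 9 * 64 * K₀ 64 8 ^ 2 * A) r₁ :=
  N18HLayerW1ConfigRecord.termBound118_of_bound238_table F K S W Wk _ hW
    (spRestr_spaceOfRecord₁₂_succ_of_hasResidualsOfRecord F N θ hθ p K α₀ α₁) han h238 hA hr₁ hrate hsmall

open Classical in
/-- **[I] p. 263 ANALYTICITY OF EVERY TERM ON THE TABLE OF RECORD, NO RESTRICTION CLAUSE**: file 10's `termAnalytic_of_bound238_table` at the same table, `hrestr`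
discharged by §3. [cite: Balaban1987RG1, §1 p.263 (analytic on U^c_j); Balaban1988RG2Cluster, p.15] -/
theorem termAnalytic_of_bound238_spaceOfRecord₁₂ (θ : Stage12Params F N) (hθ : θ.HasResidualsOfRecord) (p : B12.RunParams) (K : ℕ) (α₀ α₁ : ℕ → ℝ)
    (S : ClusterTower (F.P K) (MatA N) M) (W : Set (ℕ → ℝ)) (Wk : (k : ℕ) → Set (Fin (k + 1) → ℝ)) {A R r₁ : ℝ}
    (hW : ∀ k, ∀ g ∈ W, restrictPrefix k g ∈ Wk k)
    (han : ∀ k, (S k).AnalyticH (Wk k) (spaceOfRecord (M := M) (settingOfRecord₁₂ F N θ p) (θ.Rz K) α₀ α₁ (k + 1)))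
    (h238 : ∀ k, (S k).Bound238 (Wk k) (spaceOfRecord (M := M) (settingOfRecord₁₂ F N θ p) (θ.Rz K) α₀ α₁ (k + 1)) A R) (hA : 0 ≤ A) (hr₁ : 0 ≤ r₁)
    (hrate : r₁ + 2 * (64 * Real.log 162) + 2 ≤ R) (hsmall : A * Real.exp (5 * r₁ + 1) * K₀ 64 8 * 9 * 64 < 1) :
    TermAnalytic S W (spaceOfRecord (M := M) (settingOfRecord₁₂ F N θ p) (θ.Rz K) α₀ α₁) :=
  N18HLayerW1ConfigRecord.termAnalytic_of_bound238_table F K S W Wk _ hW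
    (spRestr_spaceOfRecord₁₂_succ_of_hasResidualsOfRecord F N θ hθ p K α₀ α₁) han h238 hA hr₁ hrate hsmall

end Consumers

end Summit.QuantumFields.YangMills.BalabanUVNodes.N18HLayerW1SpaceRestr

end
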